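import Summits.AtomisticToContinuum.HydrodynamicLimit.Theorems.AntiMazurCoboundariesKineticWindowGronwallFrameCovarianceQPrelim
import Summits.AtomisticToContinuum.HydrodynamicLimit.Theorems.AntiMazurCoboundariesKineticWindowGronwallFrameUniv
import Summits.AtomisticToContinuum.HydrodynamicLimit.Theorems.AntiMazurCoboundariesKineticWindowGronwallQuadraticMoment
import HarnessLib

/-!
# Frame covariance of the kinetic input in the quadratic class, II: the core estimate and `stub_frameCovariance`

Crux `Summit.AtomisticToContinuum.HydrodynamicLimit.Theses.AntiMazurCoboundaries.KineticWindowGronwall`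
(stmt-AtomisticToContinuum-9282), line `dlr-block-transfer` v6, REGISTERED SKELETON STUB 3a `stub_frameCovariance :
FrameCovarianceQ := KineticFluxLdDecayQuad → KineticFluxLdDecayQUniv` (lead prover, continuation c1); file 2 of 2.

Proof: as in the bounded class (`…KineticWindowGronwallFrameUniv.lean`: activity dummy, canonical flow a.e., velocity
translation of the datum, Galilean boost of the canonical flow, thermal scaling), except that freezing the moving test
function now costs `η κ Σᵢ (1 + ‖wᵢ(s)‖²)`, which along the boosted canonical flow is bounded through the conserved
kinetic energy by `η κ (c₁ (N+1) + 4 θ⁻¹ Σᵢ ‖vᵢ(0)‖²)`; the velocity-dependent factor is split off by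
`e^{A+B} ≤ e^{2A} + e^{2B}`: `e^{2A}` is the window moment of the observable `2g` (whence the halved universal amplitude),
`e^{2B}` is the static Gaussian quadratic moment `((1 − 16κη)^{-3/2})^{N+1}` (`lintegral_exp_quadratic_localGibbsLaw_le`),
and `η → 0` absorbs everything in `e^{δ(N+1)}`.
-/

noncomputable section

open MeasureTheory Filter Set Topology Function
open scoped ENNReal
open Literature.MathematicalPhysics.KineticTheory Literature.Analysis.FluidPDE
open Summit.AtomisticToContinuum.HydrodynamicLimit.Theses.AntiMazurCoboundaries
open Summit.AtomisticToContinuum.HydrodynamicLimit.Theorems.KineticWindowGronwallBoost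
open Summit.AtomisticToContinuum.HydrodynamicLimit.Theorems.KineticWindowGronwallThermalScaling
open Summit.AtomisticToContinuum.HydrodynamicLimit.Theorems.KineticWindowGronwallKineticClass (KineticFluxLdDecayQuad)
open Summit.AtomisticToContinuum.HydrodynamicLimit.Theorems.KineticWindowGronwallQuadraticMoment
  (lintegral_exp_quadratic_localGibbsLaw_le)

namespace Summit.AtomisticToContinuum.HydrodynamicLimit.Theorems.KineticWindowGronwallFrame

/-! ## §4 The core estimate and the proof of the registered statement -/

section Proof

variable {σ : ℝ} {N : ℕ}

/-- Doubling the observable doubles the one-body sum. [folklore] -/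
theorem obsSum_two_mul (φ : T3 → ℝ) (g : V3 → ℝ) (θ : ℝ) (u₀ : V3) (y : Config (N + 1) (Fin 3) T3) :
    obsSum φ (fun v => 2 * g v) θ u₀ y = 2 * obsSum φ g θ u₀ y := by
  simp only [obsSum, Finset.mul_sum]
  refine Finset.sum_congr rfl fun i _ => ?_
  ring

/-- The elementary split `e^{a+b} ≤ e^{2a} + e^{2b}`. [folklore] -/
theorem exp_add_le_exp_two_mul_add (a b : ℝ) : Real.exp (a + b) ≤ Real.exp (2 * a) + Real.exp (2 * b) := by
  rcases le_total a b with h | h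
  · have : a + b ≤ 2 * b := by linarith
    exact (Real.exp_le_exp.2 this).trans (le_add_of_nonneg_left (Real.exp_pos _).le)
  · have : a + b ≤ 2 * a := by linarith
    exact (Real.exp_le_exp.2 this).trans (le_add_of_nonneg_right (Real.exp_pos _).le)

/-- The configuration's velocity square sum is measurable. [folklore] -/
theorem measurable_sum_norm_sq : Measurable fun w : Config (N + 1) (Fin 3) T3 => ∑ i, ‖(w i).2‖ ^ 2 := by
  refine Finset.measurable_sum _ fun i _ => ?_
  exact ((measurable_pi_apply i).snd.norm).pow_const 2

/-- **THE CORE ESTIMATE, quadratic class (one frame from the unit frame).** With `Ψ₀ = boostReg … (−u₀)` the boosted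
canonical flow and `Ψ₁ = thermalScale Ψ₀ (√θ)⁻¹` its thermal rescaling: for every flow `Φ`, window `τ` with
`h = τ(N+1)^{-1/3} ≤ s₀`, tolerance `η ≥ 0` with `8 η κ < 1/2`,
`W(1,θ,u₀; Φ; φ, g; τ) ≤ e^{ηκ(N+1)(1 + 6‖u₀‖²/θ)} · (W(1,1,0; Ψ₁; φ, 2g; √θ τ) + ((1 − 16ηκ)^{-3/2})^{N+1})`. -/
theorem windowMoment_frame_le_quad (hσ : 0 < σ) (hσh : σ < 2⁻¹) {θ : ℝ} (hθ : 0 < θ) (u₀ : V3) {φ : T3 → ℝ}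
    {g : V3 → ℝ} (hφc : Continuous φ) (hgc : Continuous g) (hφ : ∀ x, |φ x| ≤ 1) {κ : ℝ} (hκ : 0 ≤ κ)
    (hg : ∀ v, |g v| ≤ κ * (1 + ‖v‖ ^ 2)) {η s₀ τ : ℝ} (hη0 : 0 ≤ η) (hηκ : 8 * (η * κ) < 1 / 2) (hτ : 0 < τ)
    (N : ℕ) (hN : τ * ((N + 1 : ℕ) : ℝ) ^ (-(1 / 3 : ℝ)) ≤ s₀)
    (hηs : ∀ s : ℝ, |s| ≤ s₀ → ∀ x : T3, |φ (x + Literature.Analysis.FunctionSpaces.Torus.proj (s • u₀)) - φ x| ≤ η)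
    (Φ : TFlow σ N) :
    windowMoment σ 1 θ u₀ N Φ φ g τ ≤
      ENNReal.ofReal (Real.exp (η * κ * (N + 1) * (1 + 6 * ‖u₀‖ ^ 2 * θ⁻¹))) *
        (windowMoment σ 1 1 0 N
            (thermalScale (boostReg (d := Fin 3) (hsDiameter_pos hσ N) (hsDiameter_lt_half hσ hσh N) (N + 1) (-u₀))
              (Real.sqrt θ)⁻¹ (inv_pos.2 (Real.sqrt_pos.2 hθ))) φ (fun v => 2 * g v) (Real.sqrt θ * τ) +
          ENNReal.ofReal (((1 - 2 * (8 * (η * κ) * θ⁻¹) * θ) ^ (-(3 / 2 : ℝ))) ^ (N + 1))) := by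
  set hε := hsDiameter_pos hσ N
  set hε' := hsDiameter_lt_half hσ hσh N
  set Ψ₀ : TFlow σ N := boostReg (d := Fin 3) hε hε' (N + 1) (-u₀) with hΨ₀
  set h : ℝ := τ * ((N + 1 : ℕ) : ℝ) ^ (-(1 / 3 : ℝ))
  set c₁ : ℝ := η * κ * (N + 1) * (1 + 6 * ‖u₀‖ ^ 2 * θ⁻¹) with hc₁
  set lam : ℝ := 8 * (η * κ) * θ⁻¹ with hlam_def
  have hh : 0 < h := window_pos hτ N
  have hC : 0 ≤ Real.exp c₁ := (Real.exp_pos _).le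
  -- Steps 1–2: canonical flow, then drift into datum and flow (as in the bounded class)
  have hP : localGibbsLaw σ (fun _ => (1 : ℝ)) (fun _ => u₀) (fun _ => θ) N Φ ≪
      liouville (Torus.geometry (Fin 3)) (N + 1) (hsDiameter σ N) := by
    rw [localGibbsLaw_eq]
    exact localGibbsMeasure_absolutelyContinuous σ _ _ _ N Φ
  have step1 : windowMoment σ 1 θ u₀ N Φ φ g τ =
      ∫⁻ z, ENNReal.ofReal (Real.exp (h⁻¹ * ∫ s in (0 : ℝ)..h,
        obsSum φ g θ u₀ (Alexander.regFlow (Torus.geometry (Fin 3)) (hsDiameter σ N) s z)))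
        ∂(localGibbsLaw σ (fun _ => (1 : ℝ)) (fun _ => u₀) (fun _ => θ) N Φ) :=
    lintegral_window_congr_regFlow hε hε' Φ hP (fun y => ENNReal.ofReal (Real.exp (h⁻¹ * y))) (obsSum φ g θ u₀) hh.le
  have step2 : ∫⁻ z, ENNReal.ofReal (Real.exp (h⁻¹ * ∫ s in (0 : ℝ)..h,
        obsSum φ g θ u₀ (Alexander.regFlow (Torus.geometry (Fin 3)) (hsDiameter σ N) s z)))
        ∂(localGibbsLaw σ (fun _ => (1 : ℝ)) (fun _ => u₀) (fun _ => θ) N Φ) =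
      ∫⁻ w, ENNReal.ofReal (Real.exp (h⁻¹ * ∫ s in (0 : ℝ)..h,
        obsSum (fun x => φ (x + Literature.Analysis.FunctionSpaces.Torus.proj (s • u₀))) g θ 0 (Ψ₀.flow s w)))
        ∂(localGibbsLaw σ (fun _ => (1 : ℝ)) (fun _ => (0 : V3)) (fun _ => θ) N Ψ₀) := by
    rw [lintegral_localGibbsLaw_velShift_zero σ 1 hθ u₀ N Ψ₀ Φ]
    refine lintegral_congr fun w => ?_
    congr 3
    refine intervalIntegral.integral_congr fun s _ => ?_
    simp only [velShift_eq_boostAt_zero, regFlow_boostAt_zero hε hε', obsSum_boostAt, hΨ₀]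
  -- Step 3: freeze the test function and split the velocity-dependent error off
  have step3 : ∫⁻ w, ENNReal.ofReal (Real.exp (h⁻¹ * ∫ s in (0 : ℝ)..h,
        obsSum (fun x => φ (x + Literature.Analysis.FunctionSpaces.Torus.proj (s • u₀))) g θ 0 (Ψ₀.flow s w)))
        ∂(localGibbsLaw σ (fun _ => (1 : ℝ)) (fun _ => (0 : V3)) (fun _ => θ) N Ψ₀) ≤
      ∫⁻ w, ENNReal.ofReal (Real.exp c₁) *
        (ENNReal.ofReal (Real.exp (h⁻¹ * ∫ s in (0 : ℝ)..h, obsSum φ (fun v => 2 * g v) θ 0 (Ψ₀.flow s w))) +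
          ENNReal.ofReal (Real.exp (lam * ∑ i, ‖(w i).2‖ ^ 2)))
        ∂(localGibbsLaw σ (fun _ => (1 : ℝ)) (fun _ => (0 : V3)) (fun _ => θ) N Ψ₀) := by
    refine lintegral_mono fun w => ?_
    have hle := window_moving_le_static_quad Ψ₀ (measurable_boostReg_flow_left hε hε' (-u₀) w)
      (sum_norm_sq_boostReg_le hε hε' u₀ w) hφc hgc hφ hκ hg hθ u₀ hh hN hη0 hηs
    set M := h⁻¹ * (∫ s in (0 : ℝ)..h,
      obsSum (fun x => φ (x + Literature.Analysis.FunctionSpaces.Torus.proj (s • u₀))) g θ 0 (Ψ₀.flow s w)) with hM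
    set S := h⁻¹ * (∫ s in (0 : ℝ)..h, obsSum φ g θ 0 (Ψ₀.flow s w)) with hS
    set Q := ∑ i, ‖(w i).2‖ ^ 2 with hQ
    have hS2 : h⁻¹ * (∫ s in (0 : ℝ)..h, obsSum φ (fun v => 2 * g v) θ 0 (Ψ₀.flow s w)) = 2 * S := by
      simp only [obsSum_two_mul, intervalIntegral.integral_const_mul, hS]
      ring
    -- `M ≤ S + c₁ + (lam/2) Q`
    have hM' : M ≤ (S + (lam / 2) * Q) + c₁ := by
      have : η * (κ * ((N + 1) + θ⁻¹ * (4 * Q + 6 * (N + 1) * ‖u₀‖ ^ 2))) = c₁ + (lam / 2) * Q := by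
        simp only [hc₁, hlam_def]
        ring
      linarith
    rw [← ENNReal.ofReal_add (Real.exp_pos _).le (Real.exp_pos _).le, ← ENNReal.ofReal_mul hC, hS2]
    refine ENNReal.ofReal_le_ofReal ?_
    calc Real.exp M ≤ Real.exp ((S + (lam / 2) * Q) + c₁) := Real.exp_le_exp.2 hM'
      _ = Real.exp c₁ * Real.exp (S + (lam / 2) * Q) := by rw [Real.exp_add, mul_comm]
      _ ≤ Real.exp c₁ * (Real.exp (2 * S) + Real.exp (lam * Q)) := by
          refine mul_le_mul_of_nonneg_left ((exp_add_le_exp_two_mul_add _ _).trans_eq ?_) hC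
          congr 2
          ring
  -- Step 4: integrate: constant out, the two summands separately
  have hmeasQ : Measurable fun w : Config (N + 1) (Fin 3) T3 =>
      ENNReal.ofReal (Real.exp (lam * ∑ i, ‖(w i).2‖ ^ 2)) :=
    (Real.measurable_exp.comp (measurable_sum_norm_sq.const_mul lam)).ennreal_ofReal
  have step4 : ∫⁻ w, ENNReal.ofReal (Real.exp c₁) *
        (ENNReal.ofReal (Real.exp (h⁻¹ * ∫ s in (0 : ℝ)..h, obsSum φ (fun v => 2 * g v) θ 0 (Ψ₀.flow s w))) +
          ENNReal.ofReal (Real.exp (lam * ∑ i, ‖(w i).2‖ ^ 2)))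
        ∂(localGibbsLaw σ (fun _ => (1 : ℝ)) (fun _ => (0 : V3)) (fun _ => θ) N Ψ₀) =
      ENNReal.ofReal (Real.exp c₁) * (windowMoment σ 1 θ 0 N Ψ₀ φ (fun v => 2 * g v) τ +
        ∫⁻ w, ENNReal.ofReal (Real.exp (lam * ∑ i, ‖(w i).2‖ ^ 2))
          ∂(localGibbsLaw σ (fun _ => (1 : ℝ)) (fun _ => (0 : V3)) (fun _ => θ) N Ψ₀)) := by
    rw [lintegral_const_mul' _ _ ENNReal.ofReal_ne_top, lintegral_add_right _ hmeasQ]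
    rfl
  have step5 : windowMoment σ 1 θ 0 N Ψ₀ φ (fun v => 2 * g v) τ =
      windowMoment σ 1 1 0 N (thermalScale Ψ₀ (Real.sqrt θ)⁻¹ (inv_pos.2 (Real.sqrt_pos.2 hθ))) φ
        (fun v => 2 * g v) (Real.sqrt θ * τ) :=
    kineticWindow_thermal_drift σ 1 hθ N Ψ₀ φ (fun v => 2 * g v) τ
  have hlamθ : lam * θ < 1 / 2 := by
    rw [hlam_def, mul_assoc, inv_mul_cancel₀ hθ.ne', mul_one]
    exact hηκ
  have step6 := lintegral_exp_quadratic_localGibbsLaw_le σ 1 hθ hlamθ N Ψ₀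
  calc windowMoment σ 1 θ u₀ N Φ φ g τ
      = _ := step1
    _ = _ := step2
    _ ≤ _ := step3
    _ = _ := step4
    _ ≤ _ := by
        rw [step5]
        exact mul_le_mul_right (add_le_add_right step6 _) _

/-- The logarithmic smallness of the Gaussian factor: for `0 ≤ x ≤ 1/4`, `(1 − x)^{-3/2} ≤ e^{2x}`. [folklore] -/
theorem one_sub_rpow_neg_three_halves_le {x : ℝ} (hx0 : 0 ≤ x) (hx : x ≤ 1 / 4) :
    (1 - x) ^ (-(3 / 2 : ℝ)) ≤ Real.exp (2 * x) := by
  have h1x : 0 < 1 - x := by linarith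
  rw [Real.rpow_def_of_pos h1x, Real.exp_le_exp]
  -- `-log(1-x) = log (1/(1-x)) ≤ 1/(1-x) - 1 = x/(1-x) ≤ (4/3) x`
  have hlog : -Real.log (1 - x) ≤ x / (1 - x) := by
    have h := Real.log_le_sub_one_of_pos (inv_pos.2 h1x)
    rw [Real.log_inv] at h
    have : (1 - x)⁻¹ - 1 = x / (1 - x) := by field_simp; ring
    linarith
  have hfrac : x / (1 - x) ≤ (4 / 3) * x := by
    rw [div_le_iff₀ h1x]
    nlinarith
  nlinarith

/-- **The budget arithmetic of the assembly** (pure real analysis): with `x = 16ηκ ≤ min δ 1 / 4`,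
`ηκ(1 + 6u/θ) ≤ δ/4` and `log 2 ≤ (δ/4)(N+1)`,
`e^{ηκ(N+1)(1+6u/θ)} (e^{(δ/2)(N+1)} + ((1 − 2(8ηκ/θ)θ)^{-3/2})^{N+1}) ≤ e^{δ(N+1)}`. [folklore] -/
theorem budget_arith {δ κ θ η u : ℝ} {N : ℕ} (hθ : 0 < θ) (hηκ0 : 0 ≤ η * κ)
    (hx : 16 * (η * κ) ≤ min δ 1 / 4) (hc : η * κ * (1 + 6 * u * θ⁻¹) ≤ δ / 4)
    (hN : Real.log 2 ≤ δ / 4 * (N + 1)) :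
    Real.exp (η * κ * (N + 1) * (1 + 6 * u * θ⁻¹)) *
        (Real.exp (δ / 2 * (N + 1)) + ((1 - 2 * (8 * (η * κ) * θ⁻¹) * θ) ^ (-(3 / 2 : ℝ))) ^ (N + 1)) ≤
      Real.exp (δ * (N + 1)) := by
  have hN1 : (0 : ℝ) < N + 1 := by positivity
  have hxθ : 2 * (8 * (η * κ) * θ⁻¹) * θ = 16 * (η * κ) := by field_simp; ring
  rw [hxθ]
  have hx0 : 0 ≤ 16 * (η * κ) := by positivity
  have hx4 : 16 * (η * κ) ≤ 1 / 4 := hx.trans (by have := min_le_right δ 1; linarith)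
  have hxδ : 2 * (16 * (η * κ)) ≤ δ / 2 := by have := min_le_left δ 1; linarith
  have hm : (1 - 16 * (η * κ)) ^ (-(3 / 2 : ℝ)) ≤ Real.exp (2 * (16 * (η * κ))) :=
    one_sub_rpow_neg_three_halves_le hx0 hx4
  have hm0 : 0 ≤ (1 - 16 * (η * κ)) ^ (-(3 / 2 : ℝ)) := Real.rpow_nonneg (by linarith) _
  have hmN : ((1 - 16 * (η * κ)) ^ (-(3 / 2 : ℝ))) ^ (N + 1) ≤ Real.exp (δ / 2 * (N + 1)) := by
    refine (pow_le_pow_left₀ hm0 hm (N + 1)).trans ?_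
    rw [← Real.exp_nat_mul]
    exact Real.exp_le_exp.2 (by push_cast; nlinarith)
  have hc₁ : η * κ * (N + 1) * (1 + 6 * u * θ⁻¹) ≤ δ / 4 * (N + 1) := by nlinarith
  calc Real.exp (η * κ * (N + 1) * (1 + 6 * u * θ⁻¹)) *
        (Real.exp (δ / 2 * (N + 1)) + ((1 - 16 * (η * κ)) ^ (-(3 / 2 : ℝ))) ^ (N + 1))
      ≤ Real.exp (δ / 4 * (N + 1)) * (Real.exp (δ / 2 * (N + 1)) + Real.exp (δ / 2 * (N + 1))) :=
        mul_le_mul (Real.exp_le_exp.2 hc₁) (add_le_add_right hmN _) (by positivity) (Real.exp_pos _).le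
    _ = Real.exp (δ / 4 * (N + 1) + Real.log 2 + δ / 2 * (N + 1)) := by
        rw [Real.exp_add, Real.exp_add, Real.exp_log two_pos]; ring
    _ ≤ Real.exp (δ * (N + 1)) := Real.exp_le_exp.2 (by nlinarith)

/-- **The tolerance of the assembly**: for `δ, κ > 0`, `θ > 0` and a drift size `u ≥ 0` there is `η > 0` with `8ηκ < 1/2`,
`16ηκ ≤ min δ 1 / 4` and `ηκ(1 + 6u/θ) ≤ δ/4` (take `η = min δ 1 / (32 κ (2 + 6u/θ))`). [folklore] -/
theorem exists_tolerance {δ κ θ u : ℝ} (hδ : 0 < δ) (hκ : 0 < κ) (hθ : 0 < θ) (hu : 0 ≤ u) :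
    ∃ η : ℝ, 0 < η ∧ 8 * (η * κ) < 1 / 2 ∧ 16 * (η * κ) ≤ min δ 1 / 4 ∧ η * κ * (1 + 6 * u * θ⁻¹) ≤ δ / 4 := by
  have hK : 0 < κ * (2 + 6 * u * θ⁻¹) := by positivity
  have hmin : 0 < min δ 1 := lt_min hδ one_pos
  have hmin1 : min δ 1 ≤ 1 := min_le_right _ _
  have hminδ : min δ 1 ≤ δ := min_le_left _ _
  have h1 : min δ 1 / (32 * (κ * (2 + 6 * u * θ⁻¹))) * κ ≤ min δ 1 / 64 := by
    rw [div_mul_eq_mul_div, div_le_div_iff₀ (by positivity) (by norm_num)]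
    have hp : 0 ≤ min δ 1 * κ * (6 * u * θ⁻¹) := by positivity
    have hring : min δ 1 * (32 * (κ * (2 + 6 * u * θ⁻¹))) = min δ 1 * κ * 64 + 32 * (min δ 1 * κ * (6 * u * θ⁻¹)) := by
      ring
    rw [hring]
    linarith
  refine ⟨min δ 1 / (32 * (κ * (2 + 6 * u * θ⁻¹))), by positivity, ?_, ?_, ?_⟩
  · nlinarith
  · nlinarith
  · have h1 : min δ 1 / (32 * (κ * (2 + 6 * u * θ⁻¹))) * κ * (1 + 6 * u * θ⁻¹) ≤ min δ 1 / 32 := by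
      rw [div_mul_eq_mul_div, div_mul_eq_mul_div, div_le_div_iff₀ (by positivity) (by norm_num)]
      have : 0 ≤ 6 * u * θ⁻¹ := by positivity
      nlinarith
    nlinarith

/-- `log 2 ≤ (δ/4)(N+1)` for all large `N`. [folklore] -/
theorem exists_log_two_le {δ : ℝ} (hδ : 0 < δ) : ∃ N₃ : ℕ, ∀ N : ℕ, N₃ ≤ N → Real.log 2 ≤ δ / 4 * (N + 1) := by
  obtain ⟨N₃, hN₃⟩ := exists_nat_gt (Real.log 2 / (δ / 4))
  refine ⟨N₃, fun N hN => ?_⟩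
  have h4 : 0 < δ / 4 := by linarith
  have hcast : (N₃ : ℝ) ≤ N := by exact_mod_cast hN
  have : Real.log 2 / (δ / 4) ≤ (N : ℝ) + 1 := by linarith
  rwa [div_le_iff₀ h4, mul_comm] at this

/-- **`A_Q → A_Q,univ`**: the quadratic-class input at the unit frame `(1, 1, 0)` yields ONE threshold `min σ₀(1,1,0) (1/2)`
and ONE amplitude `κ(1,1,0)/2` serving every frame. [folklore] -/
theorem kineticFluxLdDecayQUniv_of (hQ : KineticFluxLdDecayQuad) : KineticFluxLdDecayQUniv := by
  obtain ⟨σ₁, hσ₁, κ₁, hκ₁, H₁⟩ := hQ 1 1 0 one_pos one_pos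
  refine ⟨min σ₁ 2⁻¹, lt_min hσ₁ (by norm_num), κ₁ / 2, half_pos hκ₁, fun a θ u₀ ha hθ σ hσ hσ' => ?_⟩
  have hσ₁' : σ < σ₁ := hσ'.trans_le (min_le_left _ _)
  have hσh : σ < 2⁻¹ := hσ'.trans_le (min_le_right _ _)
  obtain ⟨hP₁, Hκ⟩ := H₁ σ hσ hσ₁'
  refine ⟨probClause_of_unit hP₁ ha hθ u₀, ?_⟩
  intro φ g hφc hgc hφ hg horth δ hδ
  have hκ : 0 < κ₁ / 2 := half_pos hκ₁
  -- the doubled observable is in the unit-frame class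
  have hg2c : Continuous fun v => 2 * g v := continuous_const.mul hgc
  have hg2 : ∀ v, |2 * g v| ≤ κ₁ * (1 + ‖v‖ ^ 2) := fun v => by
    rw [abs_mul, abs_two]
    have := hg v
    linarith
  have horth2 : OrthogonalToCollisionInvariants fun v => 2 * g v := fun c₀ c₂ b => by
    have h := horth c₀ c₂ b
    simp only [mul_assoc]
    rw [integral_const_mul, h, mul_zero]
  -- the unit-frame bound at half the rate
  obtain ⟨τ₁, hτ₁, N₁, HN₁⟩ := Hκ φ (fun v => 2 * g v) hφc hg2c hφ hg2 horth2 (δ / 2) (half_pos hδ)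
  -- tolerance and its displacement range
  obtain ⟨η, hη0, hηκ, hηx, hηc⟩ := exists_tolerance (u := ‖u₀‖ ^ 2) hδ hκ hθ (sq_nonneg _)
  obtain ⟨s₀, hs₀, hηs⟩ := exists_displacement_small φ hφc u₀ hη0
  -- the window in the frame `θ`: `√θ τ = τ₁`
  have hc : 0 < Real.sqrt θ := Real.sqrt_pos.2 hθ
  obtain ⟨τ, hτ, hττ₁⟩ : ∃ τ : ℝ, 0 < τ ∧ Real.sqrt θ * τ = τ₁ :=
    ⟨(Real.sqrt θ)⁻¹ * τ₁, mul_pos (inv_pos.2 hc) hτ₁, by rw [← mul_assoc, mul_inv_cancel₀ hc.ne', one_mul]⟩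
  obtain ⟨N₂, hN₂⟩ := exists_window_le τ hs₀
  obtain ⟨N₃, hN₃⟩ := exists_log_two_le hδ
  refine ⟨τ, hτ, max N₁ (max N₂ N₃), fun N hN Φ => ?_⟩
  have hN₁' : N₁ ≤ N := (le_max_left _ _).trans hN
  have hN₂' : N₂ ≤ N := ((le_max_left _ _).trans (le_max_right _ _)).trans hN
  have hN₃' : N₃ ≤ N := ((le_max_right _ _).trans (le_max_right _ _)).trans hN
  have hact : windowMoment σ a θ u₀ N Φ φ g τ = windowMoment σ 1 θ u₀ N Φ φ g τ := by
    simp only [windowMoment, KineticWindowGronwallNegative.localGibbsLaw_const_activity ha.ne']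
  rw [hact]
  refine (windowMoment_frame_le_quad hσ hσh hθ u₀ hφc hgc hφ hκ.le hg hη0.le hηκ hτ N (hN₂ N hN₂') hηs Φ).trans ?_
  rw [hττ₁]
  set Ψ₁ : TFlow σ N := thermalScale (boostReg (d := Fin 3) (hsDiameter_pos hσ N) (hsDiameter_lt_half hσ hσh N) (N + 1)
    (-u₀)) (Real.sqrt θ)⁻¹ (inv_pos.2 (Real.sqrt_pos.2 hθ))
  have hW : windowMoment σ 1 1 0 N Ψ₁ φ (fun v => 2 * g v) τ₁ ≤ ENNReal.ofReal (Real.exp (δ / 2 * (N + 1))) :=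
    HN₁ N hN₁' Ψ₁
  refine (mul_le_mul_right (add_le_add_left hW _) _).trans ?_
  have hm0 : 0 ≤ ((1 - 2 * (8 * (η * (κ₁ / 2)) * θ⁻¹) * θ) ^ (-(3 / 2 : ℝ))) ^ (N + 1) := by
    refine pow_nonneg (Real.rpow_nonneg ?_ _) _
    have : 2 * (8 * (η * (κ₁ / 2)) * θ⁻¹) * θ = 16 * (η * (κ₁ / 2)) := by field_simp; ring
    rw [this]
    have := min_le_right δ 1
    nlinarith [mul_pos hη0 hκ]
  rw [← ENNReal.ofReal_add (Real.exp_pos _).le hm0, ← ENNReal.ofReal_mul (Real.exp_pos _).le]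
  exact ENNReal.ofReal_le_ofReal (budget_arith hθ (mul_pos hη0 hκ).le hηx hηc (hN₃ N hN₃'))

/-- **`A_Q,univ → A_Q`**: instantiation. [folklore] -/
theorem kineticFluxLdDecayQuad_of_univ (h : KineticFluxLdDecayQUniv) : KineticFluxLdDecayQuad := by
  obtain ⟨σ₀, hσ₀, κ, hκ, H⟩ := h
  exact fun a θ u₀ ha hθ => ⟨σ₀, hσ₀, κ, hκ, fun σ hσ hσ' => H a θ u₀ ha hθ σ hσ hσ'⟩

/-- **THE REGISTERED SKELETON STUB 3a `stub_frameCovariance`** (crux `KineticWindowGronwall`, line `dlr-block-transfer` v6):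
frame covariance of the quadratic-class kinetic input. [folklore] -/
theorem stub_frameCovariance : FrameCovarianceQ :=
  kineticFluxLdDecayQUniv_of

/-- The universal and the frame-wise quadratic-class inputs are equivalent. [folklore] -/
theorem kineticFluxLdDecayQuad_iff_univ : KineticFluxLdDecayQuad ↔ KineticFluxLdDecayQUniv :=
  ⟨kineticFluxLdDecayQUniv_of, kineticFluxLdDecayQuad_of_univ⟩

end Proof

end Summit.AtomisticToContinuum.HydrodynamicLimit.Theorems.KineticWindowGronwallFrame

end
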